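import Summits.Ventures.QEC.Census.CertCoverBatch
import Summits.Ventures.QEC.Census.BB.S8_126_w6_k12_01061B01.L1Iface
import HarnessLib

set_option Elab.async false
set_option maxRecDepth 200000

/-!
# `[[252,12,16]]` one-level cover certificate of `S8_126_w6_k12_01061B01` — WITNESS TABLE round trip, part A: `orbCheckAux ePermqs eTr eInv 63` on representative chunks 0–1
(≤ 80 representatives × 63 translations each; type-12 lockstep `permWordL`; qec-type-10 `CertCoverBatch.orbCheck`). Data (chunk lists) + decided checks; KERNEL. qec-search-1 g5.
-/

namespace Summit.Ventures.QEC.Census.S8_126_w6_k12_01061B01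

open Matrix Summit.Ventures.QEC.Census Literature.InformationTheory.QuantumCodes

/-- Representatives 0–79. -/
def repsC0 : List ℕ :=
  [
    0xa009000004000000400, 0x1e01b00000c000000c00, 0x2202d000014000001400, 0x5a049000024000002401,
    0x820ad000054000005402, 0xaa089000044000004402, 0x14a109000084000008404, 0x28a209000104000010408,
    0x50a409000204000020410, 0xa0a809000404000040420, 0x140b009000804000080440, 0x22088090014040001404a0,
    0x2808009001004000100480, 0x282002d001014000101480, 0x500e009002004000200500, 0x8800009005004000500680,
    0xa002009004004000400600, 0x1101e00900a004000a00100, 0x1400e01b00800c000800800, 0x1401a009008004000800000,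
    0x1403202d008014000801000, 0x1404a049008024000802001, 0x16818009009004000900080, 0x1e01200900c004000c00200,
    0x22022009014004001400e00, 0x2800202d010014001001c00, 0x2802a009010004001000c00, 0x4405a009028004002801000,
    0x5004a009020004002001400, 0x5006202d020014002000400, 0xa008a009040004004002400, 0x14010a009080004008004400,
    0x28020a009100004010008400, 0x50040a009200004020010400, 0xa0080a009400004040020400, 0xa02008009401004040120480,
    0x140100a009800004080040400, 0x22000080084010041401a0480, 0x220280a0084000041400a0400, 0x2800808008001004100180480,
    0x280200a008000004100080400, 0x280202202c000014100081400, 0x280340b008000804100000440, 0x2808002008004004100480600,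
    0x281601a008008004100880000, 0x500400a00b000004200100400, 0x500680800b001004200000480, 0x501001a00b008004200900000,
    0x880000200c004004500680600, 0x880a00a00c000004500280400, 0xa00200200d004004400600600, 0xa00800a00d000004400200400,
    0xa008022029000014400201400, 0x1400401a009008004800c00001, 0x1401000a009000004800400401, 0x1401a002009004004800000601,
    0x2802000a009000005000800402, 0x2803401a009008005000000002, 0x5004000a009000006001000404, 0x880a000a00900000100280040a,
    0xa002008a009040000006002408, 0xa008000a009000000002000408, 0xa008002202d000010002001408, 0xa008028a209000100002010400,
    0xa0082808009001000002100488, 0xa008a002009004000002400608, 0xa009401a009008000002800008, 0xa00d004a009020000000001408,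
    0xa020020a009100000012008408, 0xa288200a008000000102080408, 0x14010000a00900000c004000410, 0x22028000a00900001000a000428,
    0x28020000a009000014008000420, 0x28020002202d000004008001420, 0x50040000a009000024010000440, 0xa00802808009001044020100400,
    0xa02000808008001044120180400, 0xa0200200a008000044120080480, 0x280080200a008000104180080600, 0x2800808002008004104180480400]

set_option maxHeartbeats 400000000 in
/-- Round trip on chunk 0 (80 representatives × 63 translations). -/
theorem orbChk0 : orbCheckAux S8_126_w6_k12_01061B01.ePermqs eTr eInv 63 repsC0 = true := by decide +kernel

/-- Representatives 80–89. -/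
def repsC1 : List ℕ :=
  [
    0x280200a002009004104080400400, 0x500100400a00b000204300100000, 0x500400050a409000004100020010, 0x5004002808009001204100100080,
    0x500400a002009004204100400200, 0x5006800808008001204000180080, 0x500680200a008000204000080000, 0x5006808002008004204000480200,
    0x501001000a009000204900400001, 0x100500401401028004820000080001]

set_option maxHeartbeats 400000000 in
/-- Round trip on chunk 1 (10 representatives × 63 translations). -/
theorem orbChk1 : orbCheckAux S8_126_w6_k12_01061B01.ePermqs eTr eInv 63 repsC1 = true := by decide +kernel


end Summit.Ventures.QEC.Census.S8_126_w6_k12_01061B01
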